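import Literature.MathematicalPhysics.QuantumFieldTheory.ConformalBootstrap3D.MeanFieldEdge
import Mathlib.Tactic
import HarnessLib

/-!
# The mean-field block expansions of `u^p` and `(u/v)^p` as formal identities

In the Hogervorst–Rychkov frame (arrays `ℤ → ℤ → ℝ`, entry `(M, j)` = coefficient of `𝒫_{2p+M, j}`) the two
generalised-free-field sources are the arrays `δ` (`u^p = 𝒫_{2p,0}`, `deltaArr`) and the Gegenbauer-to-Legendre
array of `(u/v)^p = u^p (1-z)^{-p} (1-z̄)^{-p}`,

  `gg(p; M, j) = (p-1/2)_k (p)_m (2j+1) / (k! (3/2)_m)`,  `k = (M-j)/2`, `m = (M+j)/2`  (`ggArr`),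

(the product `C^{(p)}`-Gegenbauer generating function re-expanded in Legendre polynomials). Both satisfy the
Casimir-pair closure relation `𝕃_p X(p) = μ(p) S² X(p+1)` (`closureRel_delta`, `closureRel_ggArr`; the latter
is one rational identity, `ggVal_closure_identity`), as do the mean-field block sums
(`closureRel_blockSum_mft`); the edges agree (`blockSum_mft_alt_edge`, `blockSum_mft_edge`, `ggArr_edge`);
hence, by the uniqueness engine `eq_of_closureRel`, the **formal mean-field identities**

  `Σ_{n,ℓ} (-1)^ℓ P_{n,ℓ}(p)/λ_ℓ · [g_{2p+2n+ℓ,ℓ}] = δ`        (`blockSum_mft_alt_eq_delta`),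
  `Σ_{n,ℓ} P_{n,ℓ}(p)/λ_ℓ · [g_{2p+2n+ℓ,ℓ}] = gg(p)`           (`blockSum_mft_eq_ggArr`),

for every real `p > 1/2`, where `P_{n,ℓ}(p) = mftCoeff p n ℓ` are the Fitzpatrick–Kaplan coefficients in the
tree's block normalisation and `[g]` the HR coefficient array of the block. These are the coefficient forms of
`u^p = Σ (-1)^ℓ P_{n,ℓ} g_{2p+2n+ℓ,ℓ}` and `(u/v)^p = Σ P_{n,ℓ} g_{2p+2n+ℓ,ℓ}` [cite: FitzpatrickKaplan2012, §2.2,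
the closed form for `(c̄^{12}_{n,ℓ})²` — the last display of §2.2, unnumbered in arXiv:1112.4845]
(originally [cite: HeemskerkPenedonesPolchinskiSully2009, §2]); the analytic identities on `(0,1)²`
follow in `MeanFieldDecomposition`. The proof here (closure under the quartic/quadratic Casimir pair
[cite: DolanOsborn2011, §4.2] plus leading-twist edges) is elementary and finite.
-/

namespace Literature.MathematicalPhysics.QuantumFieldTheory.ConformalBootstrap3D

open Finset

/-! ### The source array of `(u/v)^p` -/

/-- `gg(b; k, m) = (b-1/2)_k (b)_m (2(m-k)+1) / (k! (3/2)_m)`: the coefficient of `𝒫_{2b+k+m, m-k}` in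
`u^b (1-z)^{-b} (1-z̄)^{-b}` (Gegenbauer `C^{(b)}` generating function re-expanded in Legendre polynomials).
[folklore] -/
noncomputable def ggVal (b : ℝ) (k m : ℕ) : ℝ :=
  poch (b - 1 / 2) k * poch b m * (2 * ((m : ℝ) - k) + 1) / ((k.factorial : ℝ) * poch (3 / 2) m)

/-- The source array of `(u/v)^b` in the frame `b`: entry `(M, j)` (`0 ≤ j ≤ M`, `M - j` even) is
`gg(b; (M-j)/2, (M+j)/2)`, zero otherwise. [folklore] -/
noncomputable def ggArr (b : ℝ) : ℤ → ℤ → ℝ := fun M j =>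
  if 0 ≤ j ∧ j ≤ M ∧ Even (M - j) then ggVal b ((M - j) / 2).toNat ((M + j) / 2).toNat else 0

/-- `ggArr` is supported on `0 ≤ j ≤ M`, `M - j` even. [folklore] -/
theorem ggArr_eq_zero_of_not_supp (b : ℝ) {M j : ℤ} (h : ¬ (0 ≤ j ∧ j ≤ M ∧ Even (M - j))) :
    ggArr b M j = 0 := by
  unfold ggArr; rw [if_neg h]

/-- The entries of `ggArr` on its support, parametrised by `k, m`. [folklore] -/
theorem ggArr_of_supp (b : ℝ) {M j : ℤ} (k m : ℕ) (hM : M = m + k) (hj : j = m - k) (hkm : k ≤ m) :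
    ggArr b M j = ggVal b k m := by
  unfold ggArr
  rw [if_pos ⟨by omega, by omega, ⟨k, by omega⟩⟩]
  have h1 : ((M - j) / 2).toNat = k := by omega
  have h2 : ((M + j) / 2).toNat = m := by omega
  rw [h1, h2]

/-- The edge of `ggArr`: `gg(b; 0, M) = (b)_M / (1/2)_M`. [folklore] -/
theorem ggArr_edge (b : ℝ) (M : ℕ) : ggArr b M M = poch b M / poch (1 / 2) M := by
  rw [ggArr_of_supp b 0 M (by simp) (by simp) (Nat.zero_le M)]
  unfold ggVal
  -- `(3/2)_M = (1/2)_M (2M+1)`: from `(1/2)_{M+1}` written both ways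
  have h3 : poch (3 / 2) M = poch (1 / 2) M * (2 * M + 1) := by
    have h := poch_succ_left (1 / 2 : ℝ) M
    rw [poch_succ] at h
    norm_num at h
    linarith
  have hq : poch (1 / 2) M ≠ 0 := poch_ne_zero (by norm_num) M
  have hM : (2 * (M : ℝ) + 1) ≠ 0 := by positivity
  rw [h3]
  simp only [poch_zero, Nat.factorial_zero, Nat.cast_one, one_mul, Nat.cast_zero, sub_zero]
  field_simp

/-- `InRangeZ 0` is the support condition `0 ≤ j ≤ M`, `M - j` even. [folklore] -/
theorem inRangeZ_zero_iff (M j : ℤ) : InRangeZ 0 M j ↔ (0 ≤ j ∧ j ≤ M ∧ Even (M - j)) := by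
  unfold InRangeZ
  simp only [Nat.cast_zero, zero_add, add_zero, Int.even_add, Int.even_sub]
  constructor
  · rintro ⟨h1, -, h3, h4⟩; exact ⟨h1, h3, by tauto⟩
  · rintro ⟨h1, h2, h3⟩; exact ⟨h1, by omega, h2, by tauto⟩

/-- `clUp` vanishes on the leading twist: `clUp p (2p+j) j = 0`. [folklore] -/
theorem clUp_leading (p j : ℝ) : clUp p (2 * p + j) j = 0 := by
  unfold clUp; ring

/-- `clUp p E (-1) = 0`. [folklore] -/
theorem clUp_neg_one (p E : ℝ) : clUp p E (-1) = 0 := by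
  unfold clUp; ring

set_option maxHeartbeats 800000 in
/-- **The closure identity for the `(u/v)^p` source**, generic entry: with `M = j + 2k + 2`,
`ℓ_p(2p+M,j) gg(p;k+1,j+k+1) + clUp gg(p;k+1,j+k) + clDn gg(p;k,j+k+1) + clTwo gg(p;k,j+k) = μ(p) gg(p+1;k,j+k)`
— one rational identity in `p, j, k` after factoring out `(p-1/2)_k (p)_{j+k} / (k! (3/2)_{j+k})`. [folklore] -/
theorem ggVal_closure_identity {p : ℝ} (hp : 1 / 2 < p) (j k : ℕ) :
    clDiag p (2 * p + ((j : ℝ) + 2 * k + 2)) j * ggVal p (k + 1) (j + k + 1) +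
      clUp p (2 * p + ((j : ℝ) + 2 * k + 1)) ((j : ℝ) - 1) * ggVal p (k + 1) (j + k) +
      clDn p (2 * p + ((j : ℝ) + 2 * k + 1)) ((j : ℝ) + 1) * ggVal p k (j + k + 1) +
      clTwo (2 * p + ((j : ℝ) + 2 * k)) j * ggVal p k (j + k) =
    mftMu p * ggVal (p + 1) k (j + k) := by
  unfold ggVal
  -- reduce all Pochhammer symbols to the four atoms `a = (p-1/2)_k`, `b = (p)_{j+k}`, `f = k!`, `g = (3/2)_{j+k}`
  have ea : poch (p - 1 / 2) (k + 1) = poch (p - 1 / 2) k * (p - 1 / 2 + k) := poch_succ _ _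
  have eb : poch p (j + k + 1) = poch p (j + k) * (p + ↑(j + k)) := poch_succ _ _
  have ef : ((k + 1).factorial : ℝ) = ((k : ℝ) + 1) * (k.factorial : ℝ) := by
    rw [Nat.factorial_succ]; push_cast; ring
  have eg : poch (3 / 2) (j + k + 1) = poch (3 / 2) (j + k) * (3 / 2 + ↑(j + k)) := poch_succ _ _
  have ea' : poch (p + 1 - 1 / 2) k = poch (p - 1 / 2) k * (p - 1 / 2 + k) / (p - 1 / 2) := by
    rw [eq_div_iff (by linarith : (p - 1 / 2) ≠ 0)]
    have h := poch_succ_left (p - 1 / 2) k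
    rw [poch_succ] at h
    rw [show p + 1 - 1 / 2 = p - 1 / 2 + 1 by ring]
    linarith [h]
  have eb' : poch (p + 1) (j + k) = poch p (j + k) * (p + ↑(j + k)) / p := by
    rw [eq_div_iff (by linarith : p ≠ 0)]
    have h := poch_succ_left p (j + k)
    rw [poch_succ] at h
    linarith [h]
  rw [ea, eb, ef, eg, ea', eb']
  set a := poch (p - 1 / 2) k
  set b := poch p (j + k)
  set f := (k.factorial : ℝ)
  set g := poch (3 / 2) (j + k)
  have hf : f ≠ 0 := by positivity
  have hg : g ≠ 0 := poch_ne_zero (by norm_num) _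
  have hp0 : p ≠ 0 := by intro h; linarith
  have hp1 : (p - 1 / 2) ≠ 0 := by intro h; linarith
  have hk1 : ((k : ℝ) + 1) ≠ 0 := by positivity
  have hjk : (3 / 2 + ((j + k : ℕ) : ℝ)) ≠ 0 := by positivity
  have hj1 : (2 * (j : ℝ) + 1) ≠ 0 := by positivity
  have hj3 : (2 * ((j : ℝ) + 1) + 1) ≠ 0 := by positivity
  have hj2 : (2 * ((j : ℝ) - 1) + 1) ≠ 0 := by
    intro h
    have h' : (2 * j : ℤ) = 1 := by
      have : (2 : ℝ) * j = 1 := by linarith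
      exact_mod_cast this
    omega
  unfold clDiag clUp clDn clTwo mftMu
  push_cast
  field_simp
  ring

/-- **`(u/v)^p` is in the closure relation with `(u/v)^{p+1}`**: `𝕃_p gg(p) = μ(p) S² gg(p+1)` (`p > 1/2`).
[cite: DolanOsborn2011, §4.2] -/
theorem closureRel_ggArr {p : ℝ} (hp : 1 / 2 < p) : ClosureRel p (ggArr p) (ggArr (p + 1)) := by
  intro M j
  by_cases hs : 0 ≤ j ∧ j ≤ M ∧ Even (M - j)
  swap
  · -- off the support everything vanishes (the only in-range neighbour, `(M-1, 0)` for `j = -1`, has `clDn = 0`)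
    have hx : ∀ n i : ℤ, ¬ InRangeZ 0 n i → ggArr p n i = 0 := fun n i h =>
      ggArr_eq_zero_of_not_supp p (by rwa [inRangeZ_zero_iff] at h)
    rw [opL_eq_zero_of_not_inRangeZ p (2 * p) 0 hx (by rwa [inRangeZ_zero_iff]),
      ggArr_eq_zero_of_not_supp (p + 1) (fun h => hs ⟨h.1, by omega, by
        obtain ⟨r, hr⟩ := h.2.2; exact ⟨r + 1, by omega⟩⟩), mul_zero]
  obtain ⟨hj, hjM, ⟨r, hr⟩⟩ := hs
  lift j to ℕ using hj
  have hr0 : 0 ≤ r := by omega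
  lift r to ℕ using hr0
  simp only [opL]
  cases r with
  | zero =>
    -- the edge `M = j`: `clDiag` and `clUp` vanish on the leading twist, the other entries are off-support
    have hM : M = j := by omega
    subst hM
    rw [clDiag_leading, clUp_leading,
      ggArr_eq_zero_of_not_supp p (M := (j : ℤ) - 1) (j := (j : ℤ) + 1) (by omega),
      ggArr_eq_zero_of_not_supp p (M := (j : ℤ) - 2) (j := (j : ℤ)) (by omega),
      ggArr_eq_zero_of_not_supp (p + 1) (M := (j : ℤ) - 2) (j := (j : ℤ)) (by omega)]
    ring
  | succ k =>
    have hM : M = j + 2 * k + 2 := by omega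
    -- the five entries
    have t1 : ggArr p M j = ggVal p (k + 1) (j + k + 1) :=
      ggArr_of_supp p (k + 1) (j + k + 1) (by push_cast; omega) (by push_cast; omega) (by omega)
    have t2 : clUp p (2 * p + ((M - 1 : ℤ) : ℝ)) (((j : ℤ) - 1 : ℤ) : ℝ) * ggArr p (M - 1) (j - 1) =
        clUp p (2 * p + ((M - 1 : ℤ) : ℝ)) (((j : ℤ) - 1 : ℤ) : ℝ) * ggVal p (k + 1) (j + k) := by
      rcases Nat.eq_zero_or_pos j with hj0 | hjpos
      · subst hj0
        rw [show (((0 : ℕ) : ℤ) - 1 : ℤ) = -1 by simp, Int.cast_neg, Int.cast_one, clUp_neg_one]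
        ring
      · rw [ggArr_of_supp p (k + 1) (j + k) (by push_cast; omega) (by push_cast; omega) (by omega)]
    have t3 : ggArr p (M - 1) (j + 1) = ggVal p k (j + k + 1) :=
      ggArr_of_supp p k (j + k + 1) (by push_cast; omega) (by push_cast; omega) (by omega)
    have t4 : ggArr p (M - 2) j = ggVal p k (j + k) :=
      ggArr_of_supp p k (j + k) (by push_cast; omega) (by push_cast; omega) (by omega)
    have t5 : ggArr (p + 1) (M - 2) j = ggVal (p + 1) k (j + k) :=
      ggArr_of_supp (p + 1) k (j + k) (by push_cast; omega) (by push_cast; omega) (by omega)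
    rw [t2, t1, t3, t4, t5]
    have eM : ((M : ℤ) : ℝ) = (j : ℝ) + 2 * k + 2 := by rw [hM]; push_cast; ring
    have eM1 : ((M - 1 : ℤ) : ℝ) = (j : ℝ) + 2 * k + 1 := by rw [hM]; push_cast; ring
    have eM2 : ((M - 2 : ℤ) : ℝ) = (j : ℝ) + 2 * k := by rw [hM]; push_cast; ring
    have ej : (((j : ℕ) : ℤ) : ℝ) = (j : ℝ) := by push_cast; ring
    have ejm : ((((j : ℕ) : ℤ) - 1 : ℤ) : ℝ) = (j : ℝ) - 1 := by push_cast; ring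
    have ejp : ((((j : ℕ) : ℤ) + 1 : ℤ) : ℝ) = (j : ℝ) + 1 := by push_cast; ring
    rw [eM, eM1, eM2, ejm, ejp, ej]
    exact ggVal_closure_identity hp j k

/-! ### The formal mean-field identities -/

/-- **Formal mean-field identity, `u^p` family**: in the Hogervorst–Rychkov frame `2p` (`p > 1/2`),
`Σ_{n,ℓ} (-1)^ℓ P_{n,ℓ}(p)/λ_ℓ · [g_{2p+2n+ℓ,ℓ}] = δ_{(0,0)}` — the coefficient form of
`u^p = Σ_{n,ℓ} (-1)^ℓ P_{n,ℓ} g_{2p+2n+ℓ,ℓ}`. [cite: FitzpatrickKaplan2012, §2.2] -/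
theorem blockSum_mft_alt_eq_delta {p : ℝ} (hp : 1 / 2 < p) :
    blockSum p (fun n ℓ => (-1 : ℝ) ^ ℓ * mftCoeff p n ℓ / legendreLam ℓ) = deltaArr := by
  set X : ℕ → ℤ → ℤ → ℝ := fun i =>
    blockSum (p + i) (fun n ℓ => (-1 : ℝ) ^ ℓ * mftCoeff (p + i) n ℓ / legendreLam ℓ) with hX
  have hpi : ∀ i : ℕ, 1 / 2 < p + i := fun i => by
    have : (0 : ℝ) ≤ i := Nat.cast_nonneg i; linarith
  have key := eq_of_closureRel hp X (fun _ => deltaArr)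
    (fun i => by
      have h := closureRel_blockSum_mft (hpi i) (fun ℓ => (-1 : ℝ) ^ ℓ)
      simp only [hX, Nat.cast_succ]
      rwa [show p + ((i : ℝ) + 1) = p + i + 1 by ring])
    (fun i => closureRel_delta (p + i))
    (fun i M j h => blockSum_eq_zero_of_not_supp _ _ h)
    (fun i M j h => deltaArr_eq_zero_of_not_supp h)
    (fun i M => by
      simp only [hX]
      rcases lt_or_ge M 0 with hneg | hnn
      · rw [blockSum_eq_zero_of_not_supp _ _ (fun h => absurd h.1 (by omega)),
          deltaArr_eq_zero_of_not_supp (fun h => absurd h.1 (by omega))]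
      · lift M to ℕ using hnn
        rw [blockSum_mft_alt_edge (hpi i)]
        simp [deltaArr])
  simpa [hX] using key 0

/-- **Formal mean-field identity, `(u/v)^p` family**: in the Hogervorst–Rychkov frame `2p` (`p > 1/2`),
`Σ_{n,ℓ} P_{n,ℓ}(p)/λ_ℓ · [g_{2p+2n+ℓ,ℓ}] = gg(p)` — the coefficient form of
`(u/v)^p = Σ_{n,ℓ} P_{n,ℓ} g_{2p+2n+ℓ,ℓ}`. [cite: FitzpatrickKaplan2012, §2.2] -/
theorem blockSum_mft_eq_ggArr {p : ℝ} (hp : 1 / 2 < p) :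
    blockSum p (fun n ℓ => mftCoeff p n ℓ / legendreLam ℓ) = ggArr p := by
  set X : ℕ → ℤ → ℤ → ℝ := fun i =>
    blockSum (p + i) (fun n ℓ => (1 : ℝ) * mftCoeff (p + i) n ℓ / legendreLam ℓ) with hX
  have hpi : ∀ i : ℕ, 1 / 2 < p + i := fun i => by
    have : (0 : ℝ) ≤ i := Nat.cast_nonneg i; linarith
  have key := eq_of_closureRel hp X (fun i => ggArr (p + i))
    (fun i => by
      have h := closureRel_blockSum_mft (hpi i) (fun _ => (1 : ℝ))
      simp only [hX, Nat.cast_succ]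
      rwa [show p + ((i : ℝ) + 1) = p + i + 1 by ring])
    (fun i => by
      have h := closureRel_ggArr (hpi i)
      simp only [Nat.cast_succ]
      rwa [show p + ((i : ℝ) + 1) = p + i + 1 by ring])
    (fun i M j h => blockSum_eq_zero_of_not_supp _ _ h)
    (fun i M j h => ggArr_eq_zero_of_not_supp _ h)
    (fun i M => by
      simp only [hX]
      rcases lt_or_ge M 0 with hneg | hnn
      · rw [blockSum_eq_zero_of_not_supp _ _ (fun h => absurd h.1 (by omega)),
          ggArr_eq_zero_of_not_supp _ (fun h => absurd h.1 (by omega))]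
      · lift M to ℕ using hnn
        rw [blockSum_mft_edge (hpi i), ggArr_edge])
  have h0 := key 0
  simp only [hX, Nat.cast_zero, add_zero, one_mul] at h0
  exact h0

end Literature.MathematicalPhysics.QuantumFieldTheory.ConformalBootstrap3D
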